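import Mathlib

/-!
# Weighted selection of one representative per cluster (first-moment method)

Soloist file (informed mode, seat `solo-Schanuel-informed`, s184).  Second file of the seat's
THEOREM AE₃♯-1 (work note `work/s184/CLUSTER-note.md`).  Purely combinatorial, Mathlib only.

Setting.  A finite set `S` of points (naturals); for each `x ∈ S` a non-empty finite CLUSTER
`Cl x` of root indices (in `Fin D`) with positive WEIGHTS `w x i`; a finite set `A` of point
triples `(x, m, z)` with pairwise distinct coordinates in `S` (the non-trivial 3-term
progressions of `S` in the application); and a finite set `Bad` of index triples (the triples
of roots NOT in exact arithmetic progression).  A SELECTION is `r : ℕ → Fin D` with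
`r x ∈ Cl x` (`x ∈ S`); its cost is the number of `(x, m, z) ∈ A` with
`(r x, r m, r z) ∈ Bad`.

* `soloSel_exists_selection` — **there is a selection of cost at most the weighted average**
  `∑_{(x,m,z) ∈ A} ∑_{(i,j,k) ∈ (Cl x × Cl m × Cl z) ∩ Bad} p_x(i) p_m(j) p_z(k)`,
  `p_x(i) = w x i / ∑_{Cl x} w x ·` (the expectation of the cost when the representatives are
  drawn independently with probabilities `p_x`).
* Pieces (prefix `soloSel_`): `soloSel_trilinear_moment` (the joint law of three distinct
  coordinates of the product measure, via `Finset.prod_univ_sum`), `soloSel_ite_triple_eq`,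
  `soloSel_sum_ite_mem_eq`, and `soloSel_sum_filter_ge` (the heavy part of a cluster:
  `∑_{i ∈ C : θ ≤ u i} u i ≥ ∑_C u − #C · θ`).

Use (file `SoloInformedClusterStructuredRoots`).  With the AE₃ weights
`u_{x,i} = log(1/‖ρ_i − xξ‖)` a bad triple `(i, j, k)` over a progression `x + z = 2m` costs
`min(u_i, u_j, u_k) ≤ log(1/‖ρ_i + ρ_k − 2ρ_j‖) + log 4` of the AE₃ budget while its
probability is `≤ min(u)/U'` (`U'` a lower bound for the heavy cluster weights), so the
average cost is `≤ (budget + #pairs · log 4)/U'` at the FULL depth `U' ≍ n^ν`: the depth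
dilution of the served-set lemma (`SoloInformedServedSet`, one private root per point at depth
`n^ν K/(c n)`) disappears.

What this is NOT.  Elementary averaging; nothing here bears on the summit statement
`Literature.Periods.SchanuelConjecture` (the seat's verdict, no path, is unchanged), and the
device is classical (no novelty claimed).  Mathlib only; no definitions; axioms the standard
three.
-/

namespace Summit.Schanuel.Schanuel.Theorems

open Finset

section Pieces

/-- The heavy part of a cluster carries almost all the weight:
`∑_{i ∈ C} u i − #C · θ ≤ ∑_{i ∈ C : θ ≤ u i} u i` (`θ ≥ 0`). -/
theorem soloSel_sum_filter_ge {ι : Type*} (C : Finset ι) (u : ι → ℝ) {θ : ℝ} (hθ : 0 ≤ θ) :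
    ∑ i ∈ C, u i - #C * θ ≤ ∑ i ∈ C.filter (fun i => θ ≤ u i), u i := by
  classical
  have hsplit := Finset.sum_filter_add_sum_filter_not C (fun i => θ ≤ u i) u
  have hle : ∑ i ∈ C.filter (fun i => ¬ θ ≤ u i), u i ≤ #C * θ := by
    calc ∑ i ∈ C.filter (fun i => ¬ θ ≤ u i), u i
        ≤ ∑ _i ∈ C.filter (fun i => ¬ θ ≤ u i), θ :=
          Finset.sum_le_sum (fun i hi => (not_le.mp (Finset.mem_filter.mp hi).2).le)
      _ = #(C.filter (fun i => ¬ θ ≤ u i)) * θ := by rw [Finset.sum_const, nsmul_eq_mul]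
      _ ≤ #C * θ :=
          mul_le_mul_of_nonneg_right (by exact_mod_cast Finset.card_filter_le _ _) hθ
  linarith

/-- The indicator of equality of triples factors over the coordinates. -/
theorem soloSel_ite_triple_eq {κ : Type*} [DecidableEq κ] (x y z : κ) (q : κ × κ × κ) :
    (if (x, y, z) = q then (1 : ℝ) else 0) =
      (if x = q.1 then 1 else 0) * (if y = q.2.1 then 1 else 0) *
        (if z = q.2.2 then 1 else 0) := by
  obtain ⟨i, j, k⟩ := q
  simp only [Prod.mk.injEq]
  by_cases h1 : x = i <;> by_cases h2 : y = j <;> by_cases h3 : z = k <;> simp [h1, h2, h3]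

/-- A sum over `Bad` of products of three membership indicators is a sum over the filtered
box. -/
theorem soloSel_sum_ite_mem_eq {κ : Type*} [DecidableEq κ] (Bad : Finset (κ × κ × κ))
    (C₁ C₂ C₃ : Finset κ) (α β γ : κ → ℝ) :
    ∑ q ∈ Bad, (if q.1 ∈ C₁ then α q.1 else 0) * (if q.2.1 ∈ C₂ then β q.2.1 else 0) *
        (if q.2.2 ∈ C₃ then γ q.2.2 else 0) =
      ∑ q ∈ (C₁ ×ˢ (C₂ ×ˢ C₃)).filter (· ∈ Bad), α q.1 * β q.2.1 * γ q.2.2 := by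
  rw [Finset.filter_mem_eq_inter, Finset.inter_comm, ← Finset.filter_mem_eq_inter,
    Finset.sum_filter]
  refine Finset.sum_congr rfl (fun q _ => ?_)
  by_cases h1 : q.1 ∈ C₁ <;> by_cases h2 : q.2.1 ∈ C₂ <;> by_cases h3 : q.2.2 ∈ C₃ <;>
    simp [h1, h2, h3, Finset.mem_product]

/-- **Joint law of three distinct coordinates of a product measure.**  `ι` a finite index
type, `t y` finite sets, `p y ·` weights with `∑_{t y} p y · = 1`; for pairwise distinct
`a, b, d` and any test functions `e₁, e₂, e₃`:
`∑_{f ∈ Π t} (∏_y p y (f y)) · e₁(f a) e₂(f b) e₃(f d) = (∑ p a · e₁) (∑ p b · e₂) (∑ p d · e₃)`.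
-/
theorem soloSel_trilinear_moment {ι κ : Type*} [Fintype ι] [DecidableEq ι] [DecidableEq κ]
    (t : ι → Finset κ) (p : ι → κ → ℝ) (hp : ∀ y, ∑ i ∈ t y, p y i = 1) {a b d : ι}
    (hab : a ≠ b) (hbd : b ≠ d) (had : a ≠ d) (e₁ e₂ e₃ : κ → ℝ) :
    ∑ f ∈ Fintype.piFinset t, (∏ y, p y (f y)) * (e₁ (f a) * e₂ (f b) * e₃ (f d)) =
      (∑ i ∈ t a, p a i * e₁ i) * (∑ j ∈ t b, p b j * e₂ j) *
        (∑ k ∈ t d, p d k * e₃ k) := by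
  set F : ι → κ → ℝ := fun y i => p y i * ((if y = a then e₁ i else 1) *
    (if y = b then e₂ i else 1) * (if y = d then e₃ i else 1)) with hF
  have h1 : ∀ f : ι → κ,
      ∏ y, F y (f y) = (∏ y, p y (f y)) * (e₁ (f a) * e₂ (f b) * e₃ (f d)) := by
    intro f
    simp only [hF, Finset.prod_mul_distrib, Finset.prod_ite_eq', Finset.mem_univ, if_true]
  have h2 : ∀ y, ∑ i ∈ t y, F y i = (if y = a then ∑ i ∈ t a, p a i * e₁ i else 1) *
      ((if y = b then ∑ j ∈ t b, p b j * e₂ j else 1) *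
        (if y = d then ∑ k ∈ t d, p d k * e₃ k else 1)) := by
    intro y
    by_cases hya : y = a
    · subst hya
      simp only [hF, if_true, if_neg hab, if_neg had, mul_one]
    · by_cases hyb : y = b
      · subst hyb
        simp only [hF, if_true, if_neg hya, if_neg hbd, mul_one, one_mul]
      · by_cases hyd : y = d
        · subst hyd
          simp only [hF, if_true, if_neg hya, if_neg hyb, one_mul]
        · simp only [hF, if_neg hya, if_neg hyb, if_neg hyd, mul_one, hp y]
  rw [← Finset.sum_congr rfl (fun f _ => h1 f), ← Finset.prod_univ_sum,
    Finset.prod_congr rfl (fun y _ => h2 y)]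
  simp only [Finset.prod_mul_distrib, Finset.prod_ite_eq', Finset.mem_univ, if_true, mul_assoc]

end Pieces

section Selection

variable {D : ℕ}

/-- **Weighted selection (first-moment method).**  Points `S`, non-empty clusters `Cl x`
with positive weights `w x ·` (`x ∈ S`), a finite set `A` of point triples with pairwise
distinct coordinates in `S`, a finite set `Bad` of index triples.  Then some selection
`r` (`r x ∈ Cl x` for `x ∈ S`) has
`#{c ∈ A : (r c.1, r c.2.1, r c.2.2) ∈ Bad} ≤
  ∑_{c ∈ A} ∑_{q ∈ (Cl c.1 × Cl c.2.1 × Cl c.2.2) ∩ Bad} p q.1 · p q.2.1 · p q.2.2`,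
`p i = w x i / ∑_{Cl x} w x ·` (cluster of the relevant coordinate). -/
theorem soloSel_exists_selection (hD : 0 < D) (S : Finset ℕ) (Cl : ℕ → Finset (Fin D))
    (w : ℕ → Fin D → ℝ) (hw : ∀ x ∈ S, ∀ i ∈ Cl x, 0 < w x i)
    (hne : ∀ x ∈ S, (Cl x).Nonempty) (A : Finset (ℕ × ℕ × ℕ))
    (hAS : ∀ c ∈ A, c.1 ∈ S ∧ c.2.1 ∈ S ∧ c.2.2 ∈ S)
    (hAd : ∀ c ∈ A, c.1 ≠ c.2.1 ∧ c.2.1 ≠ c.2.2 ∧ c.1 ≠ c.2.2)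
    (Bad : Finset (Fin D × Fin D × Fin D)) :
    ∃ r : ℕ → Fin D, (∀ x ∈ S, r x ∈ Cl x) ∧
      (#(A.filter (fun c => (r c.1, r c.2.1, r c.2.2) ∈ Bad)) : ℝ) ≤
        ∑ c ∈ A, ∑ q ∈ (Cl c.1 ×ˢ (Cl c.2.1 ×ˢ Cl c.2.2)).filter (· ∈ Bad),
          w c.1 q.1 / (∑ i ∈ Cl c.1, w c.1 i) * (w c.2.1 q.2.1 / ∑ i ∈ Cl c.2.1, w c.2.1 i)
            * (w c.2.2 q.2.2 / ∑ i ∈ Cl c.2.2, w c.2.2 i) := by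
  classical
  -- probability weights on the subtype `S`
  set t : S → Finset (Fin D) := fun y => Cl y.1 with ht
  set p : S → Fin D → ℝ := fun y i => w y.1 i / ∑ i' ∈ Cl y.1, w y.1 i' with hp
  have hWpos : ∀ x ∈ S, 0 < ∑ i ∈ Cl x, w x i :=
    fun x hx => Finset.sum_pos (hw x hx) (hne x hx)
  have hp1 : ∀ y : S, ∑ i ∈ t y, p y i = 1 := by
    intro y
    simp only [hp, ht]
    rw [← Finset.sum_div, div_self (hWpos y.1 y.2).ne']
  have hppos : ∀ y : S, ∀ i ∈ t y, 0 < p y i :=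
    fun y i hi => div_pos (hw y.1 y.2 i hi) (hWpos y.1 y.2)
  set Ω : Finset (S → Fin D) := Fintype.piFinset t with hΩ
  set μ : (S → Fin D) → ℝ := fun f => ∏ y, p y (f y) with hμ
  have hμpos : ∀ f ∈ Ω, 0 < μ f :=
    fun f hf => Finset.prod_pos (fun y _ => hppos y (f y) (Fintype.mem_piFinset.mp hf y))
  have hΩne : Ω.Nonempty := Fintype.piFinset_nonempty.mpr (fun y => hne y.1 y.2)
  have hμ1 : ∑ f ∈ Ω, μ f = 1 := by
    rw [hΩ, hμ, ← Finset.prod_univ_sum]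
    simp only [hp1, Finset.prod_const_one]
  -- extension of a selection on `S` to all naturals
  set ext : (S → Fin D) → ℕ → Fin D :=
    fun f s => if h : s ∈ S then f ⟨s, h⟩ else ⟨0, hD⟩ with hext
  have hext_eq : ∀ f s (h : s ∈ S), ext f s = f ⟨s, h⟩ := fun f s h => by simp [hext, h]
  -- the target average
  obtain ⟨E, hE⟩ : ∃ E : ℝ, E = ∑ c ∈ A, ∑ q ∈ (Cl c.1 ×ˢ (Cl c.2.1 ×ˢ Cl c.2.2)).filter
      (· ∈ Bad), w c.1 q.1 / (∑ i ∈ Cl c.1, w c.1 i) * (w c.2.1 q.2.1 / ∑ i ∈ Cl c.2.1, w c.2.1 i)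
        * (w c.2.2 q.2.2 / ∑ i ∈ Cl c.2.2, w c.2.2 i) := ⟨_, rfl⟩
  set cost : (S → Fin D) → ℝ :=
    fun f => #(A.filter (fun c => (ext f c.1, ext f c.2.1, ext f c.2.2) ∈ Bad)) with hcost
  -- the expectation of the cost, triple by triple
  have hterm : ∀ c ∈ A, ∑ f ∈ Ω, μ f *
      (if (ext f c.1, ext f c.2.1, ext f c.2.2) ∈ Bad then (1 : ℝ) else 0) =
      ∑ q ∈ (Cl c.1 ×ˢ (Cl c.2.1 ×ˢ Cl c.2.2)).filter (· ∈ Bad),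
        w c.1 q.1 / (∑ i ∈ Cl c.1, w c.1 i) * (w c.2.1 q.2.1 / ∑ i ∈ Cl c.2.1, w c.2.1 i)
          * (w c.2.2 q.2.2 / ∑ i ∈ Cl c.2.2, w c.2.2 i) := by
    intro c hc
    obtain ⟨hx, hm, hz⟩ := hAS c hc
    obtain ⟨hxm, hmz, hxz⟩ := hAd c hc
    have hab : (⟨c.1, hx⟩ : S) ≠ ⟨c.2.1, hm⟩ := fun h => hxm (congrArg Subtype.val h)
    have hbd : (⟨c.2.1, hm⟩ : S) ≠ ⟨c.2.2, hz⟩ := fun h => hmz (congrArg Subtype.val h)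
    have had : (⟨c.1, hx⟩ : S) ≠ ⟨c.2.2, hz⟩ := fun h => hxz (congrArg Subtype.val h)
    have hind : ∀ f : S → Fin D,
        (if (ext f c.1, ext f c.2.1, ext f c.2.2) ∈ Bad then (1 : ℝ) else 0) =
        ∑ q ∈ Bad, (if f ⟨c.1, hx⟩ = q.1 then (1 : ℝ) else 0) *
          (if f ⟨c.2.1, hm⟩ = q.2.1 then 1 else 0) * (if f ⟨c.2.2, hz⟩ = q.2.2 then 1 else 0) := by
      intro f
      have hδ : (if (f ⟨c.1, hx⟩, f ⟨c.2.1, hm⟩, f ⟨c.2.2, hz⟩) ∈ Bad then (1 : ℝ) else 0) =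
          ∑ q ∈ Bad, (if (f ⟨c.1, hx⟩, f ⟨c.2.1, hm⟩, f ⟨c.2.2, hz⟩) = q then (1 : ℝ) else 0) := by
        rw [Finset.sum_ite_eq]
      rw [hext_eq f c.1 hx, hext_eq f c.2.1 hm, hext_eq f c.2.2 hz, hδ]
      exact Finset.sum_congr rfl (fun q _ => soloSel_ite_triple_eq _ _ _ q)
    simp_rw [hind, Finset.mul_sum]
    rw [Finset.sum_comm]
    have htri : ∀ q ∈ Bad, ∑ f ∈ Ω, μ f * ((if f ⟨c.1, hx⟩ = q.1 then (1 : ℝ) else 0) *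
        (if f ⟨c.2.1, hm⟩ = q.2.1 then 1 else 0) * (if f ⟨c.2.2, hz⟩ = q.2.2 then 1 else 0)) =
        (if q.1 ∈ Cl c.1 then w c.1 q.1 / ∑ i ∈ Cl c.1, w c.1 i else 0) *
          (if q.2.1 ∈ Cl c.2.1 then w c.2.1 q.2.1 / ∑ i ∈ Cl c.2.1, w c.2.1 i else 0) *
          (if q.2.2 ∈ Cl c.2.2 then w c.2.2 q.2.2 / ∑ i ∈ Cl c.2.2, w c.2.2 i else 0) := by
      intro q _
      have h := soloSel_trilinear_moment t p hp1 hab hbd had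
        (fun i => if i = q.1 then (1 : ℝ) else 0) (fun j => if j = q.2.1 then (1 : ℝ) else 0)
        (fun k => if k = q.2.2 then (1 : ℝ) else 0)
      simp only [mul_assoc] at h ⊢
      rw [hΩ, hμ] at *
      rw [h]
      simp only [ht, hp, mul_boole, Finset.sum_ite_eq']
    rw [Finset.sum_congr rfl htri]
    exact soloSel_sum_ite_mem_eq Bad (Cl c.1) (Cl c.2.1) (Cl c.2.2)
      (fun i => w c.1 i / ∑ i ∈ Cl c.1, w c.1 i) (fun j => w c.2.1 j / ∑ i ∈ Cl c.2.1, w c.2.1 i)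
      (fun k => w c.2.2 k / ∑ i ∈ Cl c.2.2, w c.2.2 i)
  have hkey : ∑ f ∈ Ω, μ f * cost f = E := by
    have hc : ∀ f, cost f =
        ∑ c ∈ A, (if (ext f c.1, ext f c.2.1, ext f c.2.2) ∈ Bad then (1 : ℝ) else 0) := by
      intro f
      rw [hcost]
      exact Finset.natCast_card_filter _ _
    simp_rw [hc, Finset.mul_sum]
    rw [Finset.sum_comm, hE]
    exact Finset.sum_congr rfl hterm
  -- pigeonhole
  have hsum : ∑ f ∈ Ω, μ f * cost f ≤ ∑ f ∈ Ω, μ f * E := by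
    rw [← Finset.sum_mul, hμ1, one_mul, hkey]
  obtain ⟨f, hf, hle⟩ := Finset.exists_le_of_sum_le hΩne hsum
  have hcostle : cost f ≤ E := le_of_mul_le_mul_left hle (hμpos f hf)
  refine ⟨ext f, fun x hx => ?_, ?_⟩
  · rw [hext_eq f x hx]
    exact Fintype.mem_piFinset.mp hf ⟨x, hx⟩
  · rw [← hE]
    exact hcostle

end Selection

end Summit.Schanuel.Schanuel.Theorems
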